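/-
Copyright (c) 2026. All rights reserved.
Released under Apache 2.0 license as described in the file LICENSE.
Authors: abc-iut cell — seat abc-iut-f-098 (F fact-proving wave, tranche 98: FACT-LIST rows F-0109, F-0110, F-0111).
-/
import Mathlib.Algebra.Module.PUnit
import Mathlib.Algebra.Field.ULift
import Mathlib.Analysis.Complex.Basic
import Literature.AnabelianGeometry.AbsoluteAnabelian.GaloisTheatersTrivialContext
import HarnessLib

/-!
# [AbsTopIII] Rmk 5.1.1 / Cor 5.2 (i): the universal closures of the named facts are false — explicit contexts

S. Mochizuki, *Topics in absolute anabelian geometry III: global reconstruction algorithms*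
[MochizukiAbsTopIII2015], Rmk 5.1.1 p. 118 and Cor 5.2 (i) p. 119 (pages of the author's manuscript, lit key
`paper:url-5493eb38cbb7`).

`GaloisTheaters.lean` types Rmk 5.1.1 and Cor 5.2 (i) as NAMED `Prop` FACTS over an abstract interface context
`R : GlobalAnabelianContext` (FACT-LIST rows F-0109 `ReferenceIsoUnique`, F-0110 `TheaterHomDeterminedByGroupHom`,
F-0111 `TheaterIsoCanonical`), each docstring saying "an ASSUMPTION on `R`: it holds for the context of Thm 1.9 /
Cor 2.8, not for an arbitrary `R`".  This PROOF-ONLY file (no `def` / `instance` / `structure` / notation; the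
contexts are built inside the theorem terms) records the kernel verdict that the rows are SCHEMATA — their universal
closures over the bare interface are FALSE:

* `exists_context_referenceIso_ne_refl` — a context satisfying every law of the interface record whose `V⊚(Π)` has
  two nonarchimedean elements with the same (trivial) decomposition group, swapped by a second reference isomorphism
  of the canonical theater `V⊚(Π)` (exactly what [NSW, Cor 12.1.3] forbids at the model); hence
  `not_forall_referenceIsoUnique` (F-0109) and, the swap being a second morphism `V⊚(Π) → V⊚(Π)` over `𝟙_Π`,
  `not_forall_theaterHomDeterminedByGroupHom` (F-0110);
* `exists_context_not_theaterIsoCanonical` — a context with one archimedean element in which `k_NF(f)` is complex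
  conjugation on `k_NF := ℂ` for every `f` (the record has no functoriality law, so `k_NF(𝟙) ≠ id` is allowed) while
  `A_X := ℂ` carries the conjugation-asymmetric topology generated by `{i}`: a morphism `V⊚(Π) → V⊚(Π)` over `𝟙_Π`
  would need `φ_v|_A =` conjugation bicontinuous for that topology; hence `not_forall_theaterIsoCanonical` (F-0111).

The positive side — the three facts DO follow from the separation / functoriality properties print's proof invokes —
is the companion file `GaloisTheatersRmk511.lean`.  HONEST LABEL: refuting the universal closure over OUR interface
record says nothing about print (the rows remain assumptions, true at the intended model, which is not in the tree —
FOUNDATIONS row 12); nothing of [AbsTopIII] is asserted or denied; nothing here bears on the disputed [IUTchIII]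
Cor. 3.12.
-/

namespace Literature.AnabelianGeometry.AbsoluteAnabelian

open CategoryTheory Topology TopologicalSpace

universe u

/-! ### The universal closures are false: explicit contexts -/

section Schema

/-- `Π = 1` is stable under isomorphisms of extensions (used for `Ob(EA⊚) := {Π = 1}` below).
[cite: MochizukiAbsTopIII2015, Def 5.1 (ii) p. 114] -/
private theorem subsingleton_arith_of_iso {E₁ E₂ : FundamentalExtension.{u}} (h : Nonempty (E₁ ≅ E₂))
    (h₁ : Subsingleton E₁.arith) : Subsingleton E₂.arith := by
  obtain ⟨e⟩ := h
  refine ⟨fun a b => ?_⟩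
  have ha : (e.inv ≫ e.hom).arith a = a := by rw [e.inv_hom_id]; rfl
  have hb : (e.inv ≫ e.hom).arith b = b := by rw [e.inv_hom_id]; rfl
  rw [← ha, ← hb, FundamentalExtension.comp_arith]
  exact congrArg e.hom.arith (Subsingleton.elim _ _)

/-- For `Π = 1`, `Δ = 1` IS the maximal topologically finitely generated closed normal subgroup.
[cite: MochizukiAbsTopIII2015, Def 5.1 (ii) p. 113] -/
private theorem isMaxTopFGClosedNormal_geom_of_subsingleton (E : FundamentalExtension.{u})
    (hE : Subsingleton E.arith) : IsMaxTopFGClosedNormal E.geom :=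
  { normal := inferInstanceAs E.aug.toMonoidHom.ker.Normal
    isClosed := E.isClosed_geom
    topFG := ⟨∅, eq_top_iff.mpr fun x _ => by rw [Subsingleton.elim x 1]; exact one_mem _⟩
    maximal := fun _ _ _ _ x _ => by rw [Subsingleton.elim x 1]; exact one_mem _ }

/-- In the topology generated by the single open set `{c}`, every nonempty open set contains `c` (so a bijection
moving `c` is not continuous). [cite: MochizukiAbsTopIII2015, Rmk 5.1.1 p. 118] -/
private theorem mem_of_generateOpen_singleton {α : Type*} (c : α) {s : Set α}
    (hs : GenerateOpen ({{c}} : Set (Set α)) s) : s.Nonempty → c ∈ s := by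
  induction hs with
  | basic u hu => exact fun _ => by rw [Set.mem_singleton_iff.mp hu]; rfl
  | univ => exact fun _ => Set.mem_univ c
  | inter u v _ _ ihu ihv =>
    exact fun h => ⟨ihu (h.mono Set.inter_subset_left), ihv (h.mono Set.inter_subset_right)⟩
  | sUnion S _ ih => exact fun ⟨x, u, huS, hxu⟩ => ⟨u, huS, ih u huS ⟨x, hxu⟩⟩

/-- **A context with a non-identity reference isomorphism.**  `Ob(EA⊚) := {Π = 1}` (iso-stable; `Δ = Π = 1` is the
maximal topologically finitely generated closed normal subgroup), `k_NF := ℚ`, `V⊚(Π) := {⊚, v₁, v₂}` discrete with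
the trivial `Π`-action, `V^non = {v₁, v₂}`, `V^arc = ∅`: every law of `GlobalAnabelianContext` holds, and for the
canonical theater `V⊚(1)` both the identity and the swap `v₁ ↔ v₂` satisfy conditions (a), (b) of Def 5.1 (iii) —
the two nonarchimedean elements have the same decomposition group, which is what [NSW, Cor 12.1.3] forbids at the
model. [cite: MochizukiAbsTopIII2015, Rmk 5.1.1 p. 118] -/
theorem exists_context_referenceIso_ne_refl :
    ∃ (R : GlobalAnabelianContext.{u}) (E : FundamentalExtension.{u}) (hE : R.IsAdmissible E)
      (ψ : (R.proVal E).carrier ≃ₜ (R.proVal E).carrier),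
      (R.theater E hE).IsReferenceIso ψ ∧ ψ ≠ Homeomorph.refl _ ∧ ∀ v, v ∉ (R.proVal E).arc := by
  let V : ∀ E : FundamentalExtension.{u}, GaloisProSet E.arith := fun E =>
    letI : MulAction E.arith (ULift.{u} (Fin 3)) :=
      { smul := fun _ v => v, one_smul := fun _ => rfl, mul_smul := fun _ _ _ => rfl }
    haveI : ContinuousSMul E.arith (ULift.{u} (Fin 3)) := ⟨continuous_snd⟩
    { carrier := ULift.{u} (Fin 3)
      generic := ⟨0⟩
      non := {v | v ≠ ⟨0⟩}
      arc := ∅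
      smul_generic := fun _ => rfl
      generic_notMem_non := fun h => h rfl
      generic_notMem_arc := fun h => h
      disjoint_non_arc := Set.disjoint_empty _
      eq_generic_or_mem := fun v => by
        by_cases h : v = ⟨0⟩
        · exact Or.inl h
        · exact Or.inr (Or.inl h)
      smul_mem_non := fun _ _ h => h
      smul_mem_arc := fun _ _ h => h }
  let R : GlobalAnabelianContext.{u} :=
    { IsAdmissible := fun E => Subsingleton E.arith
      isAdmissible_of_iso := fun h h₁ => subsingleton_arith_of_iso h h₁
      geom_isMax := isMaxTopFGClosedNormal_geom_of_subsingleton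
      kNF := fun _ => ULift.{u} ℚ
      instField := fun _ => inferInstance
      instAction := fun E => MulSemiringAction.compHom _ (1 : E.arith →* (ULift.{u} ℚ →+* ULift.{u} ℚ))
      proVal := V
      archSpace := fun _ v => v.2.elim
      δell := fun _ v => v.2.elim
      κell := fun _ v => v.2.elim
      mapProVal := fun _ _ => Homeomorph.refl _
      mapProVal_smul := fun _ _ _ _ => rfl
      mapKNF := fun _ _ => RingEquiv.refl _ }
  let E₁ : FundamentalExtension.{u} :=
    { arith := ProfiniteGrp.of PUnit.{u + 1}, gal := ProfiniteGrp.of PUnit.{u + 1}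
      aug := ContinuousMonoidHom.id _, aug_surjective := Function.surjective_id }
  have hE₁ : R.IsAdmissible E₁ := inferInstanceAs (Subsingleton PUnit)
  -- the swap `v₁ ↔ v₂`
  let a : ULift.{u} (Fin 3) := ⟨1⟩
  let b : ULift.{u} (Fin 3) := ⟨2⟩
  have h0a : (⟨0⟩ : ULift.{u} (Fin 3)) ≠ a := fun h => absurd (congrArg ULift.down h) (by decide)
  have h0b : (⟨0⟩ : ULift.{u} (Fin 3)) ≠ b := fun h => absurd (congrArg ULift.down h) (by decide)
  have hba : b ≠ a := fun h => absurd (congrArg ULift.down h) (by decide)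
  let τ : ULift.{u} (Fin 3) ≃ₜ ULift.{u} (Fin 3) :=
    { toEquiv := Equiv.swap a b
      continuous_toFun := continuous_of_discreteTopology
      continuous_invFun := continuous_of_discreteTopology }
  have hτ0 : τ ⟨0⟩ = ⟨0⟩ := Equiv.swap_apply_of_ne_of_ne h0a h0b
  refine ⟨R, E₁, hE₁, τ, ⟨fun _ _ => rfl, hτ0, ?_, Set.image_empty _, fun v => v.2.elim⟩, fun h => ?_,
    fun v hv => hv⟩
  · -- `τ '' V^non = V^non`
    ext x
    constructor
    · rintro ⟨y, hy, rfl⟩ h0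
      exact hy (τ.injective (h0.trans hτ0.symm))
    · intro hx
      exact ⟨τ.symm x, fun h => hx (by rw [← τ.apply_symm_apply x, h, hτ0]), τ.apply_symm_apply x⟩
  · -- `τ ≠ id`
    have hτa : τ a = a := by rw [h]; rfl
    exact hba ((Equiv.swap_apply_left a b).symm.trans hτa)

/-- **Rmk 5.1.1 (uniqueness of `ψ_V`) is NOT a theorem of the bare interface**: the universal closure of the
named fact `ReferenceIsoUnique` is false (witness: `exists_context_referenceIso_ne_refl`).  The row is a schema:
an assumption on `R`, true at the intended model (where it follows from the separation properties of
`referenceIsoUnique_of_separated`). [cite: MochizukiAbsTopIII2015, Rmk 5.1.1 p. 118] -/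
theorem not_forall_referenceIsoUnique : ¬ ∀ R : GlobalAnabelianContext.{u}, ReferenceIsoUnique R := by
  intro h
  obtain ⟨R, E, hE, ψ, hψ, hne, -⟩ := exists_context_referenceIso_ne_refl.{u}
  exact hne (h R (R.theater E hE) ψ (Homeomorph.refl _) hψ (R.refl_isReferenceIsoFor E))

/-- **Rmk 5.1.1, last sentence (`φ_V` determined by `φ_Π`) is NOT a theorem of the bare interface**: over the
context of `exists_context_referenceIso_ne_refl` the identity and the swap are two morphisms `V⊚(1) → V⊚(1)` over
`𝟙_Π` (no archimedean elements, so condition (b) is vacuous). [cite: MochizukiAbsTopIII2015, Rmk 5.1.1 p. 118] -/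
theorem not_forall_theaterHomDeterminedByGroupHom :
    ¬ ∀ R : GlobalAnabelianContext.{u}, TheaterHomDeterminedByGroupHom R := by
  intro h
  obtain ⟨R, E, hE, ψ, ⟨hsmul, hgen, hnon, harc, -⟩, hne, hnoarc⟩ := exists_context_referenceIso_ne_refl.{u}
  exact hne (h R (R.theater E hE) (R.theater E hE)
    { φgrp := 𝟙 E
      isEAHom := isEAHom_id E
      φV := ψ
      φV_smul := hsmul
      φV_generic := hgen
      image_non := hnon
      image_arc := harc
      arch_compat := fun v _ => (hnoarc v v.2).elim }
    { φgrp := 𝟙 E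
      isEAHom := isEAHom_id E
      φV := Homeomorph.refl _
      φV_smul := fun _ _ => rfl
      φV_generic := rfl
      image_non := Set.image_id _
      image_arc := Set.image_id _
      arch_compat := fun v _ => (hnoarc v v.2).elim } rfl)

/-- **A context at which Cor 5.2 (i) (essential surjectivity) fails.**  `Ob(EA⊚) := {Π = 1}`, `k_NF := ℂ` with
`k_NF(f) :=` complex conjugation for EVERY morphism `f` (so `k_NF(𝟙) ≠ id`: the interface record has no
functoriality law), `V⊚(Π) := {⊚, v}` with one archimedean element, `X(Π, v) :=` a point with `A_X := ℂ` topologised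
by the single open set `{i}` and `π₁^∧ := Δ`, `δ_{ell} := id`, `κ_{ell} := id`.  A morphism `V⊚(1) → V⊚(1)` over
`𝟙` needs `φ_v` with `φ_v|_A = κ ∘ k_NF(𝟙) ∘ κ⁻¹ =` conjugation AND bicontinuous on `A` — but conjugation moves `i`,
the generic point of every nonempty open set. [cite: MochizukiAbsTopIII2015, Cor 5.2 (i) p. 119] -/
theorem exists_context_not_theaterIsoCanonical :
    ∃ R : GlobalAnabelianContext.{u}, (∃ E, R.IsAdmissible E) ∧ ¬ TheaterIsoCanonical R := by
  -- the field `k_NF = A := ℂ` (lifted), complex conjugation `σ`, the point `c = i` with `σ c ≠ c`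
  let K : Type u := ULift.{u} ℂ
  let σ : K ≃+* K := ULift.ringEquiv.trans ((starRingAut : RingAut ℂ).trans ULift.ringEquiv.symm)
  let c : K := ⟨Complex.I⟩
  have hσc : σ c ≠ c := fun h => by
    have h' : (starRingEnd ℂ) Complex.I = Complex.I := congrArg ULift.down h
    rw [Complex.conj_I] at h'
    norm_num [Complex.ext_iff] at h'
  -- the topology on `A` generated by `{c}`
  let t : TopologicalSpace K := generateFrom {{c}}
  let X : FundamentalExtension.{u} → AutHolOrbispace.{u} := fun E =>
    { carrier := PUnit.{u + 1}, fieldA := K, topA := t, pi1Hat := E.geomGrp }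
  let V : ∀ E : FundamentalExtension.{u}, GaloisProSet E.arith := fun E =>
    letI : MulAction E.arith (ULift.{u} Bool) :=
      { smul := fun _ v => v, one_smul := fun _ => rfl, mul_smul := fun _ _ _ => rfl }
    haveI : ContinuousSMul E.arith (ULift.{u} Bool) := ⟨continuous_snd⟩
    { carrier := ULift.{u} Bool
      generic := ⟨false⟩
      non := ∅
      arc := {v | v = ⟨true⟩}
      smul_generic := fun _ => rfl
      generic_notMem_non := fun h => h
      generic_notMem_arc := fun h => Bool.false_ne_true (congrArg ULift.down h)
      disjoint_non_arc := Set.empty_disjoint _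
      eq_generic_or_mem := fun v => by
        obtain ⟨_ | _⟩ := v
        · exact Or.inl rfl
        · exact Or.inr (Or.inr rfl)
      smul_mem_non := fun _ _ h => h
      smul_mem_arc := fun _ _ h => h }
  let R : GlobalAnabelianContext.{u} :=
    { IsAdmissible := fun E => Subsingleton E.arith
      isAdmissible_of_iso := fun h h₁ => subsingleton_arith_of_iso h h₁
      geom_isMax := isMaxTopFGClosedNormal_geom_of_subsingleton
      kNF := fun _ => K
      instField := fun _ => inferInstance
      instAction := fun E => MulSemiringAction.compHom _ (1 : E.arith →* (K →+* K))
      proVal := V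
      archSpace := fun E _ => X E
      δell := fun _ _ => ContinuousMulEquiv.refl _
      κell := fun _ _ => RingHom.id K
      mapProVal := fun _ _ => Homeomorph.refl _
      mapProVal_smul := fun _ _ _ _ => rfl
      mapKNF := fun _ _ => σ }
  let E₁ : FundamentalExtension.{u} :=
    { arith := ProfiniteGrp.of PUnit.{u + 1}, gal := ProfiniteGrp.of PUnit.{u + 1}
      aug := ContinuousMonoidHom.id _, aug_surjective := Function.surjective_id }
  have hE₁ : R.IsAdmissible E₁ := inferInstanceAs (Subsingleton PUnit)
  refine ⟨R, ⟨E₁, hE₁⟩, fun h => ?_⟩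
  obtain ⟨φ, -⟩ := h (R.theater E₁ hE₁)
  -- the archimedean element `v` and its image `φ_V(v) (= v)`
  have ha : (⟨true⟩ : ULift.{u} Bool) ∈ (R.proVal E₁).arc := rfl
  have hwa : φ.φV ⟨true⟩ ∈ (R.theater E₁ hE₁).V.arc := by
    rw [← φ.image_arc]
    exact ⟨_, ha, rfl⟩
  obtain ⟨φv, hh, -, hκ⟩ := φ.arch_compat ⟨⟨true⟩, ha⟩ hwa
  -- `φ_v|_A = σ` pointwise, and `φ_v|_A` is continuous for `t`: contradiction at `c`
  have hκc : σ c = φv.fieldIso c := hκ c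
  have hopen : IsOpen[t] (φv.fieldIso ⁻¹' {c}) :=
    (isOpen_generateFrom_of_mem (Set.mem_singleton ({c} : Set K))).preimage hh.continuous
  have hc : c ∈ φv.fieldIso ⁻¹' {c} :=
    mem_of_generateOpen_singleton c (s := φv.fieldIso ⁻¹' {c}) hopen
      ⟨φv.fieldIso.symm c, show φv.fieldIso (φv.fieldIso.symm c) = c from φv.fieldIso.apply_symm_apply c⟩
  exact hσc (hκc.trans hc)

/-- **Cor 5.2 (i) (essential surjectivity of `An⊚[Th⊚] → Th⊚`) is NOT a theorem of the bare interface**: the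
universal closure of the named fact `TheaterIsoCanonical` is false (witness: `exists_context_not_theaterIsoCanonical`,
a context violating `k_NF(𝟙) = id`).  The row is a schema: an assumption on `R`, true wherever `k_NF(−)` is
functorial at identities (`theaterIsoCanonical_of_mapKNF_id`). [cite: MochizukiAbsTopIII2015, Cor 5.2 (i) p. 119] -/
theorem not_forall_theaterIsoCanonical : ¬ ∀ R : GlobalAnabelianContext.{u}, TheaterIsoCanonical R := by
  intro h
  obtain ⟨R, -, hR⟩ := exists_context_not_theaterIsoCanonical.{u}
  exact hR (h R)

end Schema

end Literature.AnabelianGeometry.AbsoluteAnabelian
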